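import Mathlib

/-!
# Nodal propagator decay (route `NodalWardXY`, item `NodalPropagatorDecay`): II. oscillatory integrals

Generic one-dimensional Fourier-decay toolkit (no physics, no definitions):

* `integral_phase_mul_eq_of_periodic`: integration by parts of `∫_{-π}^{π} e^{inθ} g(θ) dθ` for a
  `C¹` function with `g(-π) = g(π)` and `n ∈ ℤ ∖ {0}` (no boundary terms);
* `norm_integral_phase_mul_le_one/three`: hence `‖∫ e^{inθ} g‖ ≤ ‖g'‖₁/|n|` and `≤ ‖g'''‖₁/|n|³`;
* `integral_abs_sin_mul_comp_cos`: the substitution `s = a cos θ + b`,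
  `∫_{-π}^{π} |a sin θ| φ(a cos θ + b) dθ = 2 ∫_{b-a}^{b+a} φ`;
* `norm_integral_phase_comp_cos_le`: for `G(θ) = f(a cos θ + b)` with `f ∈ C³` and
  `‖f⁽ᵏ⁾‖_{L¹(any interval)} ≤ A_k`, the two bounds `‖∫ e^{inθ} G‖ ≤ 2A₁/|n|` and
  `≤ 2(A₁ + 3aA₂ + a²A₃)/|n|³`.

These are the harmonic-analysis steps of the `|x|⁻²` decay of the nodal BdG propagator: the second
bound is used for momentum lines far (`≳ 1/|n|`) from the nodes, the first for the near ones.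
-/

noncomputable section

namespace Summit.HubbardSuperconductivity.HubbardSuperconductivity.Theorems

namespace NodalDecay

open Real MeasureTheory intervalIntegral

/-- The phase `e^{i n θ}` written exactly as it appears in the item (`exp (I · ↑(θ · n))`). -/
local notation "e⟪" n ", " θ "⟫" => Complex.exp (Complex.I * (((θ : ℝ) * ((n : ℤ) : ℝ) : ℝ) : ℂ))

/-! ### The phase -/

/-- `‖e^{inθ}‖ = 1`. -/
theorem norm_phase (n : ℤ) (θ : ℝ) : ‖e⟪n, θ⟫‖ = 1 := by
  rw [mul_comm]; exact Complex.norm_exp_ofReal_mul_I _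

/-- `θ ↦ e^{inθ}` is continuous. -/
theorem continuous_phase (n : ℤ) : Continuous fun θ : ℝ => e⟪n, θ⟫ := by
  fun_prop

/-- `(e^{inθ})' = e^{inθ} · (i n)`. -/
theorem hasDerivAt_phase (n : ℤ) (θ : ℝ) :
    HasDerivAt (fun x : ℝ => e⟪n, x⟫) (e⟪n, θ⟫ * (Complex.I * n)) θ := by
  have h := ((((hasDerivAt_id' θ).mul_const (n : ℝ)).ofReal_comp).const_mul Complex.I).cexp
  refine h.congr_deriv ?_
  push_cast
  ring

/-- `e^{in(-π)} = e^{inπ}` for `n ∈ ℤ`. -/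
theorem phase_neg_pi (n : ℤ) : e⟪n, -π⟫ = e⟪n, π⟫ := by
  rw [Complex.exp_eq_exp_iff_exists_int]
  refine ⟨-n, ?_⟩
  push_cast
  ring

/-! ### Integration by parts against the phase on `[-π, π]` -/

/-- Integration by parts without boundary terms: for `g ∈ C¹` with `g(-π) = g(π)` and `n ≠ 0`,
`∫_{-π}^{π} e^{inθ} g = -(∫_{-π}^{π} e^{inθ} g') / (i n)`. -/
theorem integral_phase_mul_eq_of_periodic {n : ℤ} (hn : n ≠ 0) {g g' : ℝ → ℂ}
    (hg : ∀ θ, HasDerivAt g (g' θ) θ) (hg' : Continuous g') (hper : g (-π) = g π) :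
    ∫ θ in (-π)..π, e⟪n, θ⟫ * g θ = -(∫ θ in (-π)..π, e⟪n, θ⟫ * g' θ) / (Complex.I * n) := by
  have hIn : (Complex.I * n : ℂ) ≠ 0 := mul_ne_zero Complex.I_ne_zero (Int.cast_ne_zero.2 hn)
  have hvd : ∀ θ, HasDerivAt (fun x : ℝ => e⟪n, x⟫ / (Complex.I * n)) (e⟪n, θ⟫) θ := by
    intro θ
    refine ((hasDerivAt_phase n θ).div_const (Complex.I * n)).congr_deriv ?_
    field_simp
  have h := intervalIntegral.integral_mul_deriv_eq_deriv_mul (a := -π) (b := π) (u := g)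
    (v := fun x : ℝ => e⟪n, x⟫ / (Complex.I * n)) (u' := g') (v' := fun θ => e⟪n, θ⟫)
    (fun x _ => hg x) (fun x _ => hvd x) (hg'.intervalIntegrable _ _)
    ((continuous_phase n).intervalIntegrable _ _)
  calc ∫ θ in (-π)..π, e⟪n, θ⟫ * g θ = ∫ θ in (-π)..π, g θ * e⟪n, θ⟫ := by
        congr 1; ext θ; ring
    _ = g π * (e⟪n, π⟫ / (Complex.I * n)) - g (-π) * (e⟪n, -π⟫ / (Complex.I * n))
          - ∫ θ in (-π)..π, g' θ * (e⟪n, θ⟫ / (Complex.I * n)) := h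
    _ = -∫ θ in (-π)..π, g' θ * (e⟪n, θ⟫ / (Complex.I * n)) := by rw [hper, phase_neg_pi]; ring
    _ = -(∫ θ in (-π)..π, e⟪n, θ⟫ * g' θ) / (Complex.I * n) := by
        rw [neg_div, ← intervalIntegral.integral_div]
        congr 2; ext θ; ring

/-- One integration by parts: `‖∫ e^{inθ} g‖ ≤ ‖g'‖_{L¹[-π,π]} / |n|`. -/
theorem norm_integral_phase_mul_le_one {n : ℤ} (hn : n ≠ 0) {g g' : ℝ → ℂ}
    (hg : ∀ θ, HasDerivAt g (g' θ) θ) (hg' : Continuous g') (hper : g (-π) = g π) :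
    ‖∫ θ in (-π)..π, e⟪n, θ⟫ * g θ‖ ≤ (∫ θ in (-π)..π, ‖g' θ‖) / |(n : ℝ)| := by
  rw [integral_phase_mul_eq_of_periodic hn hg hg' hper, norm_div, norm_neg, norm_mul,
    Complex.norm_I, one_mul, Complex.norm_intCast]
  gcongr
  calc ‖∫ θ in (-π)..π, e⟪n, θ⟫ * g' θ‖ ≤ ∫ θ in (-π)..π, ‖e⟪n, θ⟫ * g' θ‖ :=
        intervalIntegral.norm_integral_le_integral_norm (by linarith [Real.pi_pos])
    _ = ∫ θ in (-π)..π, ‖g' θ‖ := by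
        congr 1; ext θ; rw [norm_mul, norm_phase, one_mul]

/-- Three integrations by parts: `‖∫ e^{inθ} g‖ ≤ ‖g'''‖_{L¹[-π,π]} / |n|³` for `g ∈ C³` with
`g, g', g''` taking equal values at `±π`. -/
theorem norm_integral_phase_mul_le_three {n : ℤ} (hn : n ≠ 0) {g g1 g2 g3 : ℝ → ℂ}
    (h0 : ∀ θ, HasDerivAt g (g1 θ) θ) (h1 : ∀ θ, HasDerivAt g1 (g2 θ) θ)
    (h2 : ∀ θ, HasDerivAt g2 (g3 θ) θ) (hc3 : Continuous g3)
    (hp0 : g (-π) = g π) (hp1 : g1 (-π) = g1 π) (hp2 : g2 (-π) = g2 π) :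
    ‖∫ θ in (-π)..π, e⟪n, θ⟫ * g θ‖ ≤ (∫ θ in (-π)..π, ‖g3 θ‖) / |(n : ℝ)| ^ 3 := by
  have hc1 : Continuous g1 := continuous_iff_continuousAt.2 fun θ => (h1 θ).continuousAt
  have hc2 : Continuous g2 := continuous_iff_continuousAt.2 fun θ => (h2 θ).continuousAt
  have hnR : (0 : ℝ) < |(n : ℝ)| := abs_pos.2 (Int.cast_ne_zero.2 hn)
  rw [integral_phase_mul_eq_of_periodic hn h0 hc1 hp0, integral_phase_mul_eq_of_periodic hn h1 hc2 hp1,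
    norm_div, norm_neg, norm_div, norm_neg, norm_mul, Complex.norm_I, one_mul, Complex.norm_intCast]
  have h3 := norm_integral_phase_mul_le_one hn h2 hc3 hp2
  rw [div_div, le_div_iff₀ (by positivity)]
  rw [le_div_iff₀ hnR] at h3
  have key : ∀ X : ℝ, X / (|(n:ℝ)| * |(n:ℝ)|) * |(n:ℝ)| ^ 3 = X * |(n:ℝ)| := by
    intro X; field_simp
  rw [key]
  exact h3

/-! ### The substitution `s = a cos θ + b` -/

/-- `(a cos θ + b)' = -(a sin θ)`. -/
theorem hasDerivAt_affine_cos (a b θ : ℝ) :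
    HasDerivAt (fun x => a * Real.cos x + b) (-(a * Real.sin θ)) θ := by
  refine (((Real.hasDerivAt_cos θ).const_mul a).add_const b).congr_deriv ?_
  ring

/-- Substitution on `[0, π]`: `∫_0^π (a sin θ) φ(a cos θ + b) dθ = ∫_{b-a}^{b+a} φ`. -/
theorem integral_sin_mul_comp_cos_of_Icc {φ : ℝ → ℝ} (hφ : Continuous φ) (a b : ℝ) :
    ∫ θ in (0:ℝ)..π, (a * Real.sin θ) * φ (a * Real.cos θ + b) = ∫ s in (b - a)..(b + a), φ s := by
  have h := intervalIntegral.integral_comp_mul_deriv (a := 0) (b := π)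
    (f := fun x => a * Real.cos x + b) (f' := fun θ => -(a * Real.sin θ)) (g := φ)
    (fun θ _ => hasDerivAt_affine_cos a b θ) (by fun_prop) hφ
  simp only [Function.comp_def, Real.cos_zero, mul_one, Real.cos_pi, mul_neg, mul_one] at h
  have e1 : ∫ θ in (0:ℝ)..π, (a * Real.sin θ) * φ (a * Real.cos θ + b)
      = -∫ θ in (0:ℝ)..π, -(φ (a * Real.cos θ + b) * (a * Real.sin θ)) := by
    rw [← intervalIntegral.integral_neg]; congr 1; ext θ; ring
  rw [e1, h, intervalIntegral.integral_symm, neg_neg, show -a + b = b - a by ring,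
    show a + b = b + a by ring]

/-- Substitution on `[-π, 0]`: `∫_{-π}^0 (-(a sin θ)) φ(a cos θ + b) dθ = ∫_{b-a}^{b+a} φ`. -/
theorem integral_neg_sin_mul_comp_cos_of_Icc {φ : ℝ → ℝ} (hφ : Continuous φ) (a b : ℝ) :
    ∫ θ in (-π)..(0:ℝ), (-(a * Real.sin θ)) * φ (a * Real.cos θ + b)
      = ∫ s in (b - a)..(b + a), φ s := by
  have h := intervalIntegral.integral_comp_mul_deriv (a := -π) (b := 0)
    (f := fun x => a * Real.cos x + b) (f' := fun θ => -(a * Real.sin θ)) (g := φ)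
    (fun θ _ => hasDerivAt_affine_cos a b θ) (by fun_prop) hφ
  simp only [Function.comp_def, Real.cos_zero, mul_one, Real.cos_neg, Real.cos_pi, mul_neg,
    mul_one] at h
  have e1 : ∫ θ in (-π)..(0:ℝ), (-(a * Real.sin θ)) * φ (a * Real.cos θ + b)
      = ∫ θ in (-π)..(0:ℝ), -(φ (a * Real.cos θ + b) * (a * Real.sin θ)) := by
    congr 1; ext θ; ring
  rw [e1, h, show -a + b = b - a by ring, show a + b = b + a by ring]

/-- The substitution identity on the full period: for `a ≥ 0` and continuous `φ`,
`∫_{-π}^{π} |a sin θ| φ(a cos θ + b) dθ = 2 ∫_{b-a}^{b+a} φ`. -/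
theorem integral_abs_sin_mul_comp_cos {φ : ℝ → ℝ} (hφ : Continuous φ) {a : ℝ} (ha : 0 ≤ a) (b : ℝ) :
    ∫ θ in (-π)..π, |a * Real.sin θ| * φ (a * Real.cos θ + b) = 2 * ∫ s in (b - a)..(b + a), φ s := by
  have hcont : Continuous fun θ => |a * Real.sin θ| * φ (a * Real.cos θ + b) := by fun_prop
  rw [← intervalIntegral.integral_add_adjacent_intervals (b := 0) (hcont.intervalIntegrable _ _)
    (hcont.intervalIntegrable _ _)]
  have hL : ∫ θ in (-π)..(0:ℝ), |a * Real.sin θ| * φ (a * Real.cos θ + b)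
      = ∫ θ in (-π)..(0:ℝ), (-(a * Real.sin θ)) * φ (a * Real.cos θ + b) := by
    apply intervalIntegral.integral_congr
    intro θ hθ
    rw [Set.uIcc_of_le (by linarith [Real.pi_pos])] at hθ
    have hs : Real.sin θ ≤ 0 := Real.sin_nonpos_of_nonpos_of_neg_pi_le hθ.2 hθ.1
    simp only
    rw [abs_of_nonpos (mul_nonpos_of_nonneg_of_nonpos ha hs)]
  have hR : ∫ θ in (0:ℝ)..π, |a * Real.sin θ| * φ (a * Real.cos θ + b)
      = ∫ θ in (0:ℝ)..π, (a * Real.sin θ) * φ (a * Real.cos θ + b) := by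
    apply intervalIntegral.integral_congr
    intro θ hθ
    rw [Set.uIcc_of_le Real.pi_pos.le] at hθ
    have hs : 0 ≤ Real.sin θ := Real.sin_nonneg_of_nonneg_of_le_pi hθ.1 hθ.2
    simp only
    rw [abs_of_nonneg (mul_nonneg ha hs)]
  rw [hL, hR, integral_neg_sin_mul_comp_cos_of_Icc hφ, integral_sin_mul_comp_cos_of_Icc hφ]
  ring

/-! ### Fourier decay of `θ ↦ f(a cos θ + b)` -/

/-- Chain rule for `θ ↦ f(a cos θ + b)`. -/
theorem hasDerivAt_comp_affine_cos {f f' : ℝ → ℝ} (hf : ∀ s, HasDerivAt f (f' s) s) (a b θ : ℝ) :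
    HasDerivAt (fun x => f (a * Real.cos x + b))
      (f' (a * Real.cos θ + b) * (-(a * Real.sin θ))) θ :=
  (hf (a * Real.cos θ + b)).comp θ (hasDerivAt_affine_cos a b θ)

/-- **Fourier decay of a profile composed with `a cos θ + b`.**  Let `f ∈ C³(ℝ)` with derivatives
`f1, f2, f3` whose `L¹`-norm on every interval is at most `A₁, A₂, A₃`.  Then for `a ≥ 0`, `b ∈ ℝ`
and `n ∈ ℤ ∖ {0}`,
`‖∫_{-π}^{π} e^{inθ} f(a cos θ + b) dθ‖ ≤ 2A₁/|n|` and `≤ 2(A₁ + 3aA₂ + a²A₃)/|n|³`. -/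
theorem norm_integral_phase_comp_cos_le {f f1 f2 f3 : ℝ → ℝ} {A1 A2 A3 : ℝ}
    (hd0 : ∀ s, HasDerivAt f (f1 s) s) (hd1 : ∀ s, HasDerivAt f1 (f2 s) s)
    (hd2 : ∀ s, HasDerivAt f2 (f3 s) s) (hc3 : Continuous f3)
    (hA1 : ∀ x y, x ≤ y → ∫ s in x..y, |f1 s| ≤ A1) (hA2 : ∀ x y, x ≤ y → ∫ s in x..y, |f2 s| ≤ A2)
    (hA3 : ∀ x y, x ≤ y → ∫ s in x..y, |f3 s| ≤ A3)
    {a : ℝ} (ha : 0 ≤ a) (b : ℝ) {n : ℤ} (hn : n ≠ 0) :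
    ‖∫ θ in (-π)..π, e⟪n, θ⟫ * (f (a * Real.cos θ + b) : ℂ)‖ ≤ 2 * A1 / |(n : ℝ)| ∧
    ‖∫ θ in (-π)..π, e⟪n, θ⟫ * (f (a * Real.cos θ + b) : ℂ)‖
      ≤ 2 * (A1 + 3 * a * A2 + a ^ 2 * A3) / |(n : ℝ)| ^ 3 := by
  have hc1 : Continuous f1 := continuous_iff_continuousAt.2 fun s => (hd1 s).continuousAt
  have hc2 : Continuous f2 := continuous_iff_continuousAt.2 fun s => (hd2 s).continuousAt
  have hba : b - a ≤ b + a := by linarith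
  -- the composite and its derivatives (real-valued)
  set S : ℝ → ℝ := fun θ => a * Real.cos θ + b with hS
  set G1 : ℝ → ℝ := fun θ => -(a * Real.sin θ) * f1 (S θ) with hG1
  set G2 : ℝ → ℝ := fun θ => -(a * Real.cos θ) * f1 (S θ) + (a * Real.sin θ) ^ 2 * f2 (S θ) with hG2
  set G3 : ℝ → ℝ := fun θ => (a * Real.sin θ) * f1 (S θ) + 3 * ((a * Real.sin θ) * (a * Real.cos θ))
    * f2 (S θ) - (a * Real.sin θ) ^ 3 * f3 (S θ) with hG3
  have hDS : ∀ θ, HasDerivAt S (-(a * Real.sin θ)) θ := fun θ => hasDerivAt_affine_cos a b θ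
  have hsin : ∀ θ, HasDerivAt (fun x => a * Real.sin x) (a * Real.cos θ) θ :=
    fun θ => ((Real.hasDerivAt_sin θ).const_mul a)
  have hcos : ∀ θ, HasDerivAt (fun x => a * Real.cos x) (-(a * Real.sin θ)) θ := fun θ => by
    simpa using ((Real.hasDerivAt_cos θ).const_mul a)
  have hD0 : ∀ θ, HasDerivAt (fun x => f (S x)) (G1 θ) θ := fun θ => by
    refine ((hd0 (S θ)).comp θ (hDS θ)).congr_deriv ?_
    simp only [hG1]; ring
  have hD1 : ∀ θ, HasDerivAt G1 (G2 θ) θ := fun θ => by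
    refine (((hsin θ).fun_neg).fun_mul ((hd1 (S θ)).comp θ (hDS θ))).congr_deriv ?_
    simp only [hG2, Function.comp_def]; ring
  have hD2 : ∀ θ, HasDerivAt G2 (G3 θ) θ := fun θ => by
    refine ((((hcos θ).fun_neg).fun_mul ((hd1 (S θ)).comp θ (hDS θ))).fun_add
      (((hsin θ).fun_pow 2).fun_mul ((hd2 (S θ)).comp θ (hDS θ)))).congr_deriv ?_
    simp only [hG3, Function.comp_def]; norm_num; ring
  have hcG3 : Continuous G3 := by
    simp only [hG3, hS]; fun_prop
  -- complexify
  have hD0c : ∀ θ, HasDerivAt (fun x => (f (S x) : ℂ)) ((G1 θ : ℝ) : ℂ) θ := fun θ => (hD0 θ).ofReal_comp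
  have hD1c : ∀ θ, HasDerivAt (fun x => (G1 x : ℂ)) ((G2 θ : ℝ) : ℂ) θ := fun θ => (hD1 θ).ofReal_comp
  have hD2c : ∀ θ, HasDerivAt (fun x => (G2 x : ℂ)) ((G3 θ : ℝ) : ℂ) θ := fun θ => (hD2 θ).ofReal_comp
  have hcG3c : Continuous fun x => (G3 x : ℂ) := Complex.continuous_ofReal.comp hcG3
  have hcG1c : Continuous fun x => (G1 x : ℂ) :=
    Complex.continuous_ofReal.comp (continuous_iff_continuousAt.2 fun θ => (hD1 θ).continuousAt)
  -- periodicity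
  have hSπ : S (-π) = S π := by simp [hS]
  have hp0 : (f (S (-π)) : ℂ) = f (S π) := by rw [hSπ]
  have hp1 : (G1 (-π) : ℂ) = G1 π := by simp [hG1]
  have hp2 : (G2 (-π) : ℂ) = G2 π := by simp [hG2, hS]
  -- L¹ bounds of G1 and G3 by substitution
  have hI1 : ∫ θ in (-π)..π, ‖(G1 θ : ℂ)‖ ≤ 2 * A1 := by
    have e : ∀ θ, ‖(G1 θ : ℂ)‖ = |a * Real.sin θ| * |f1 (a * Real.cos θ + b)| := by
      intro θ; rw [Complex.norm_real, Real.norm_eq_abs, hG1]; simp only [hS]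
      rw [abs_mul, abs_neg]
    simp_rw [e]
    rw [integral_abs_sin_mul_comp_cos (φ := fun s => |f1 s|) (by fun_prop) ha b]
    linarith [hA1 _ _ hba]
  have hI3 : ∫ θ in (-π)..π, ‖(G3 θ : ℂ)‖ ≤ 2 * (A1 + 3 * a * A2 + a ^ 2 * A3) := by
    have hle : ∀ θ, ‖(G3 θ : ℂ)‖ ≤ |a * Real.sin θ| * |f1 (a * Real.cos θ + b)|
        + 3 * a * (|a * Real.sin θ| * |f2 (a * Real.cos θ + b)|)
        + a ^ 2 * (|a * Real.sin θ| * |f3 (a * Real.cos θ + b)|) := by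
      intro θ
      rw [Complex.norm_real, Real.norm_eq_abs, hG3]; simp only [hS]
      have h1 : |a * Real.sin θ| ≤ a := by
        rw [abs_mul, abs_of_nonneg ha]
        exact mul_le_of_le_one_right ha (Real.abs_sin_le_one θ)
      have hc : |a * Real.cos θ| ≤ a := by
        rw [abs_mul, abs_of_nonneg ha]
        exact mul_le_of_le_one_right ha (Real.abs_cos_le_one θ)
      have hsn : 0 ≤ |a * Real.sin θ| := abs_nonneg _
      calc |a * Real.sin θ * f1 (a * Real.cos θ + b)
            + 3 * (a * Real.sin θ * (a * Real.cos θ)) * f2 (a * Real.cos θ + b)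
            - (a * Real.sin θ) ^ 3 * f3 (a * Real.cos θ + b)|
          ≤ |a * Real.sin θ * f1 (a * Real.cos θ + b)|
            + |3 * (a * Real.sin θ * (a * Real.cos θ)) * f2 (a * Real.cos θ + b)|
            + |(a * Real.sin θ) ^ 3 * f3 (a * Real.cos θ + b)| := by
            refine (abs_sub _ _).trans ?_
            gcongr
            exact abs_add_le _ _
        _ = |a * Real.sin θ| * |f1 (a * Real.cos θ + b)|
            + 3 * |a * Real.cos θ| * (|a * Real.sin θ| * |f2 (a * Real.cos θ + b)|)
            + |a * Real.sin θ| ^ 2 * (|a * Real.sin θ| * |f3 (a * Real.cos θ + b)|) := by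
            simp only [abs_mul, abs_pow, show |(3:ℝ)| = 3 by norm_num]; ring
        _ ≤ |a * Real.sin θ| * |f1 (a * Real.cos θ + b)|
            + 3 * a * (|a * Real.sin θ| * |f2 (a * Real.cos θ + b)|)
            + a ^ 2 * (|a * Real.sin θ| * |f3 (a * Real.cos θ + b)|) := by
            gcongr
    calc ∫ θ in (-π)..π, ‖(G3 θ : ℂ)‖
        ≤ ∫ θ in (-π)..π, (|a * Real.sin θ| * |f1 (a * Real.cos θ + b)|
          + 3 * a * (|a * Real.sin θ| * |f2 (a * Real.cos θ + b)|)
          + a ^ 2 * (|a * Real.sin θ| * |f3 (a * Real.cos θ + b)|)) := by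
          apply intervalIntegral.integral_mono_on (by linarith [Real.pi_pos])
            ((Complex.continuous_ofReal.comp hcG3).norm.intervalIntegrable _ _)
            (Continuous.intervalIntegrable (by fun_prop) _ _)
          intro θ _; exact hle θ
      _ = 2 * (∫ s in (b - a)..(b + a), |f1 s|) + 3 * a * (2 * ∫ s in (b - a)..(b + a), |f2 s|)
          + a ^ 2 * (2 * ∫ s in (b - a)..(b + a), |f3 s|) := by
          rw [intervalIntegral.integral_add, intervalIntegral.integral_add,
            intervalIntegral.integral_const_mul, intervalIntegral.integral_const_mul,
            integral_abs_sin_mul_comp_cos (φ := fun s => |f1 s|) (by fun_prop) ha b,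
            integral_abs_sin_mul_comp_cos (φ := fun s => |f2 s|) (by fun_prop) ha b,
            integral_abs_sin_mul_comp_cos (φ := fun s => |f3 s|) (by fun_prop) ha b]
          all_goals exact Continuous.intervalIntegrable (by fun_prop) _ _
      _ ≤ 2 * A1 + 3 * a * (2 * A2) + a ^ 2 * (2 * A3) := by
          have := hA1 _ _ hba; have := hA2 _ _ hba; have := hA3 _ _ hba
          gcongr
      _ = 2 * (A1 + 3 * a * A2 + a ^ 2 * A3) := by ring
  have hnR : (0 : ℝ) < |(n : ℝ)| := abs_pos.2 (Int.cast_ne_zero.2 hn)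
  constructor
  · calc ‖∫ θ in (-π)..π, e⟪n, θ⟫ * (f (a * Real.cos θ + b) : ℂ)‖
        ≤ (∫ θ in (-π)..π, ‖(G1 θ : ℂ)‖) / |(n : ℝ)| :=
          norm_integral_phase_mul_le_one hn hD0c hcG1c hp0
      _ ≤ 2 * A1 / |(n : ℝ)| := by gcongr
  · calc ‖∫ θ in (-π)..π, e⟪n, θ⟫ * (f (a * Real.cos θ + b) : ℂ)‖
        ≤ (∫ θ in (-π)..π, ‖(G3 θ : ℂ)‖) / |(n : ℝ)| ^ 3 :=
          norm_integral_phase_mul_le_three hn hD0c hD1c hD2c hcG3c hp0 hp1 hp2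
      _ ≤ 2 * (A1 + 3 * a * A2 + a ^ 2 * A3) / |(n : ℝ)| ^ 3 := by gcongr

end NodalDecay

end Summit.HubbardSuperconductivity.HubbardSuperconductivity.Theorems
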